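import Mathlib
import Literature.Analysis.UnboundedOperators.UnitaryRepSpectralMeasure
import HarnessLib

/-!
# Enflo 2023, v2 eq. (1): the minimal-norm vector `ℓ'` — existence, uniqueness, active constraint

Source under adjudication: Per H. Enflo, *On the invariant subspace problem in Hilbert spaces*, arXiv:2305.15442 (v1
2023, v2 2024), bib key `Enflo2023` — a CLAIMED proof of the invariant subspace problem for operators on a separable
Hilbert space.  This file is part of the kernel-tight typing of the manuscript by the b2b-enflo repair cell
(formaliser 1, Part A: v2 eq. (1)–(27), the set-up, the constructions `V_y`, `ℓ'`, `[ ]x₀`, Lemma 1 and Case I/II of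
the main step).  It records what FOLLOWS (proved implications from the manuscript's displayed hypotheses) and, where a
step does not follow, the typed inference together with its refutation.  NOTHING here asserts that the manuscript's
main theorem holds; no declaration concludes the invariant subspace problem for an arbitrary operator.  Value
(BLOCK-2b): theorems / refutations of typed inferences about a text — not progress on the problem.

THE EXTREMAL PROBLEM of v2 p.2, eq. (1):  given a bounded operator `V : E → H` between Hilbert spaces
(in the paper `E = ℓ²`, `V = V_{y'}`, `V a = Σ a_j T^j y'`, eq. (2)), a vector `x₀` and `ε > 0`,
minimise `‖a‖` subject to `‖x₀ - V a‖ ≤ ε`.  This file is the *abstract* part of (1): it does not know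
that `E = ℓ²`; the concrete `V_y` is in `Vy.lean`; the Lagrange identity (5) and (6)–(9) are in `MinimalNorm.lean`.

Results (paper ↔ Lean; the paper's `⟨u, v⟩` (linear in `u`) is Mathlib's `⟪v, u⟫_ℂ`):
* `feasible`, `IsMinimal`                         — the problem (1);
* `exists_isMinimal`, `IsMinimal.unique`          — a minimal `ℓ'` exists (feasible set non-empty, `E` complete) and is unique;
* `IsMinimal.ne_zero`, `IsMinimal.norm_sub_eq`    — `ℓ' ≠ 0` and the constraint is active, `‖x₀ - V ℓ'‖ = ε`
                                                    (both need `ε < ‖x₀‖`; in the paper `‖x₀‖ = 1`, `ε < 1`);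
* `IsMinimal.re_inner_nonneg`                     — the variational inequality behind "the minimality of ‖ℓ'‖₂ gives".
Completeness of `E`, `H` is NOT assumed here except for existence (`exists_isMinimal`, `[CompleteSpace E]`).
Origin: planner-b2b-enflo-1-0, 2026-08-18.  Mathlib, plus the landed folklore lemma `inner_self_eq_coe_norm_sq` (`Literature.Analysis.UnboundedOperators`, imported for de-duplication).
-/

noncomputable section

open scoped InnerProductSpace ComplexConjugate
open ContinuousLinearMap
open Literature.Analysis.UnboundedOperators (inner_self_eq_coe_norm_sq)

namespace Literature.Analysis.OperatorTheory.Enflo2023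


variable {E H : Type*}
  [NormedAddCommGroup E] [InnerProductSpace ℂ E]
  [NormedAddCommGroup H] [InnerProductSpace ℂ H]

/-- Feasible set of problem (1): coefficient vectors `a` with `‖x₀ - V a‖ ≤ ε`. [cite: Enflo2023, v2 p.2, eq. (1)] -/
def feasible (V : E →L[ℂ] H) (x₀ : H) (ε : ℝ) : Set E := {a | ‖x₀ - V a‖ ≤ ε}

/-- `a` is a minimal solution of (1) (the paper's `ℓ'`, resp. `ℓ'_ε`): feasible and of least norm. [cite: Enflo2023, v2 p.2, eq. (1)] -/
def IsMinimal (V : E →L[ℂ] H) (x₀ : H) (ε : ℝ) (a : E) : Prop :=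
  a ∈ feasible V x₀ ε ∧ ∀ b ∈ feasible V x₀ ε, ‖a‖ ≤ ‖b‖

section basic
variable (V : E →L[ℂ] H) (x₀ : H) (ε : ℝ)

/-- Membership in the feasible set of (1) unfolds to `‖x₀ − V a‖ ≤ ε`. [cite: Enflo2023, v2 p.2, eq. (1)] -/
lemma mem_feasible {a : E} : a ∈ feasible V x₀ ε ↔ ‖x₀ - V a‖ ≤ ε := Iff.rfl

/-- Convex combinations (with real coefficients, written as complex scalars) stay feasible. [folklore] -/
lemma segment_mem_feasible {a b : E} (ha : a ∈ feasible V x₀ ε) (hb : b ∈ feasible V x₀ ε)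
    {s t : ℝ} (hs : 0 ≤ s) (ht : 0 ≤ t) (hst : s + t = 1) :
    (s : ℂ) • a + (t : ℂ) • b ∈ feasible V x₀ ε := by
  simp only [feasible, Set.mem_setOf_eq] at ha hb ⊢
  have hsplit : x₀ - V ((s : ℂ) • a + (t : ℂ) • b) = (s : ℂ) • (x₀ - V a) + (t : ℂ) • (x₀ - V b) := by
    have hx : x₀ = (s : ℂ) • x₀ + (t : ℂ) • x₀ := by
      rw [← add_smul]; norm_cast; rw [hst]; simp
    rw [map_add, map_smul, map_smul]
    conv_lhs => rw [hx]
    simp only [smul_sub]; abel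
  rw [hsplit]
  calc ‖(s : ℂ) • (x₀ - V a) + (t : ℂ) • (x₀ - V b)‖
      ≤ ‖(s : ℂ) • (x₀ - V a)‖ + ‖(t : ℂ) • (x₀ - V b)‖ := norm_add_le _ _
    _ = s * ‖x₀ - V a‖ + t * ‖x₀ - V b‖ := by
        rw [norm_smul, norm_smul, Complex.norm_real, Complex.norm_real, Real.norm_of_nonneg hs,
          Real.norm_of_nonneg ht]
    _ ≤ s * ε + t * ε := by gcongr
    _ = ε := by rw [← add_mul, hst, one_mul]

/-- The feasible set of (1) is closed (a closed ball pulled back by the continuous affine map `a ↦ x₀ − V a`). [folklore] -/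
lemma isClosed_feasible : IsClosed (feasible V x₀ ε) := by
  have : feasible V x₀ ε = (fun a => ‖x₀ - V a‖) ⁻¹' Set.Iic ε := rfl
  rw [this]
  exact isClosed_Iic.preimage (by fun_prop)

/-- A minimal solution exists as soon as the feasible set is non-empty (Hilbert projection theorem
`exists_norm_eq_iInf_of_complete_convex`, applied to `0` and the closed convex set `feasible`, with `E` viewed
as a real inner product space exactly as Mathlib does for `Submodule.exists_norm_eq_iInf_of_complete_subspace`). [cite: Enflo2023, v2 p.2, eq. (1)] -/
theorem exists_isMinimal [CompleteSpace E] (hne : (feasible V x₀ ε).Nonempty) : ∃ a, IsMinimal V x₀ ε a := by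
  letI : InnerProductSpace ℝ E := InnerProductSpace.rclikeToReal ℂ E
  letI : Module ℝ E := RestrictScalars.module ℝ ℂ E
  have hc : Convex ℝ (feasible V x₀ ε) := by
    intro a ha b hb s t hs ht hst
    have h1 : s • a = (s : ℂ) • a := rfl
    have h2 : t • b = (t : ℂ) • b := rfl
    rw [h1, h2]
    exact segment_mem_feasible V x₀ ε ha hb hs ht hst
  have hK : IsComplete (feasible V x₀ ε) := (isClosed_feasible V x₀ ε).isComplete
  obtain ⟨a, ha, heq⟩ := exists_norm_eq_iInf_of_complete_convex hne hK hc (0 : E)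
  refine ⟨a, ha, fun b hb => ?_⟩
  have hbdd : BddBelow (Set.range fun w : feasible V x₀ ε => ‖(0 : E) - (w : E)‖) :=
    ⟨0, by rintro _ ⟨w, rfl⟩; exact norm_nonneg _⟩
  have h1 : ‖(0 : E) - a‖ ≤ ‖(0 : E) - ((⟨b, hb⟩ : feasible V x₀ ε) : E)‖ := by
    rw [heq]; exact ciInf_le hbdd ⟨b, hb⟩
  simpa using h1

end basic

namespace IsMinimal

variable {V : E →L[ℂ] H} {x₀ : H} {ε : ℝ} {a : E}

/-- A minimal vector is feasible. [cite: Enflo2023, v2 p.2, eq. (1)] -/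
lemma mem (h : IsMinimal V x₀ ε a) : a ∈ feasible V x₀ ε := h.1

/-- A minimal vector satisfies the constraint `‖x₀ − V ℓ'‖ ≤ ε`. [cite: Enflo2023, v2 p.2, eq. (1)] -/
lemma norm_sub_le (h : IsMinimal V x₀ ε a) : ‖x₀ - V a‖ ≤ ε := h.1

/-- A minimal vector has norm at most that of any feasible vector. [cite: Enflo2023, v2 p.2, eq. (1)] -/
lemma norm_le (h : IsMinimal V x₀ ε a) {b : E} (hb : b ∈ feasible V x₀ ε) : ‖a‖ ≤ ‖b‖ := h.2 b hb

/-- If a minimal vector exists then `0 ≤ ε`. [cite: Enflo2023, v2 p.2, eq. (1)] -/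
lemma eps_nonneg (h : IsMinimal V x₀ ε a) : 0 ≤ ε := le_trans (norm_nonneg _) h.norm_sub_le

/-- If `ε < ‖x₀‖` then `0` is infeasible, so the minimal solution is non-zero. [cite: Enflo2023, v2 p.2, eq. (1)] -/
lemma ne_zero (h : IsMinimal V x₀ ε a) (hε : ε < ‖x₀‖) : a ≠ 0 := by
  rintro rfl
  have := h.norm_sub_le
  simp at this
  linarith

/-- The constraint is active at a minimal solution: `‖x₀ - V ℓ'‖ = ε` (if it were `< ε`, shrinking `ℓ'`
slightly would stay feasible and lower the norm).  Needs `ε < ‖x₀‖` (so that `ℓ' ≠ 0`). [cite: Enflo2023, v2 pp.2–3, after eq. (1)] -/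
theorem norm_sub_eq (h : IsMinimal V x₀ ε a) (hε : ε < ‖x₀‖) : ‖x₀ - V a‖ = ε := by
  refine le_antisymm h.norm_sub_le ?_
  by_contra hlt
  push Not at hlt
  have ha := h.ne_zero hε
  set η := ε - ‖x₀ - V a‖ with hη
  have hη0 : 0 < η := by linarith
  set s : ℝ := min (1 / 2) (η / (2 * (‖V a‖ + 1))) with hs
  have hs0 : 0 < s := lt_min (by norm_num) (div_pos hη0 (by positivity))
  have hs1 : s ≤ 1 / 2 := min_le_left _ _
  have hs2 : s ≤ η / (2 * (‖V a‖ + 1)) := min_le_right _ _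
  have hsVa : s * ‖V a‖ ≤ η / 2 := by
    calc s * ‖V a‖ ≤ η / (2 * (‖V a‖ + 1)) * ‖V a‖ := by gcongr
      _ ≤ η / (2 * (‖V a‖ + 1)) * (‖V a‖ + 1) := by gcongr; linarith
      _ = η / 2 := by field_simp
  have hfeas : ((1 - s : ℝ) : ℂ) • a ∈ feasible V x₀ ε := by
    rw [mem_feasible, map_smul]
    have : x₀ - ((1 - s : ℝ) : ℂ) • V a = (x₀ - V a) + (s : ℂ) • V a := by
      push_cast; rw [sub_smul, one_smul]; abel
    rw [this]
    calc ‖x₀ - V a + (s : ℂ) • V a‖ ≤ ‖x₀ - V a‖ + ‖(s : ℂ) • V a‖ := norm_add_le _ _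
      _ = ‖x₀ - V a‖ + s * ‖V a‖ := by rw [norm_smul, Complex.norm_real, Real.norm_of_nonneg hs0.le]
      _ ≤ ε := by linarith
  have hle := h.norm_le hfeas
  rw [norm_smul, Complex.norm_real, Real.norm_of_nonneg (by linarith)] at hle
  have : 0 < ‖a‖ := norm_pos_iff.2 ha
  nlinarith

/-- The variational inequality: `Re ⟪ℓ', b - ℓ'⟫ ≥ 0` for every feasible `b` (the point of the convex set
`feasible` nearest to `0` is `ℓ'`).  Direct proof along the segment from `ℓ'` to `b`. [cite: Enflo2023, v2 p.3, "the minimality of ‖ℓ'‖₂ gives"] -/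
theorem re_inner_nonneg (h : IsMinimal V x₀ ε a) {b : E} (hb : b ∈ feasible V x₀ ε) :
    0 ≤ (⟪a, b - a⟫_ℂ).re := by
  set R : ℝ := (⟪a, b - a⟫_ℂ).re with hR
  set D : ℝ := ‖b - a‖ ^ 2 with hD
  have hD0 : 0 ≤ D := by positivity
  have hseg : ∀ t : ℝ, 0 ≤ t → t ≤ 1 → a + (t : ℂ) • (b - a) ∈ feasible V x₀ ε := by
    intro t ht0 ht1
    have := segment_mem_feasible V x₀ ε h.mem hb (s := 1 - t) (t := t) (by linarith) ht0 (by ring)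
    convert this using 1
    push_cast
    simp only [sub_smul, one_smul, smul_sub]
    abel
  have hquad : ∀ t : ℝ, 0 ≤ t → t ≤ 1 → 0 ≤ 2 * t * R + t ^ 2 * D := by
    intro t ht0 ht1
    have h1 := h.norm_le (hseg t ht0 ht1)
    have h2 : ‖a + (t : ℂ) • (b - a)‖ ^ 2 = ‖a‖ ^ 2 + 2 * t * R + t ^ 2 * D := by
      rw [@norm_add_sq ℂ, inner_smul_right, norm_smul, hR, hD]
      simp only [RCLike.re_to_complex, Complex.re_ofReal_mul, Complex.norm_real, Real.norm_eq_abs,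
        abs_of_nonneg ht0]
      ring
    have h3 : ‖a‖ ^ 2 ≤ ‖a + (t : ℂ) • (b - a)‖ ^ 2 := pow_le_pow_left₀ (norm_nonneg _) h1 2
    linarith
  by_contra hneg
  push Not at hneg
  have hD1 : 0 < D + 1 := by linarith
  set t : ℝ := min 1 (-R / (D + 1)) with ht
  have ht0 : 0 < t := lt_min one_pos (div_pos (by linarith) hD1)
  have ht1 : t ≤ 1 := min_le_left _ _
  have ht2 : t ≤ -R / (D + 1) := min_le_right _ _
  have htD : t * D < -R := by
    have : t * (D + 1) ≤ -R := by
      calc t * (D + 1) ≤ (-R / (D + 1)) * (D + 1) := by gcongr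
        _ = -R := by field_simp
    nlinarith
  have hq := hquad t ht0.le ht1
  have hkey : 0 ≤ 2 * R + t * D := by
    have : 0 ≤ t * (2 * R + t * D) := by nlinarith
    exact (mul_nonneg_iff_of_pos_left ht0).1 this
  linarith

/-- Uniqueness of the minimal solution (strict convexity of the norm). [cite: Enflo2023, v2 p.2, eq. (1)] -/
theorem unique (h : IsMinimal V x₀ ε a) {b : E} (hb : IsMinimal V x₀ ε b) : a = b := by
  have h1 := h.re_inner_nonneg hb.mem
  have h2 := hb.re_inner_nonneg h.mem
  have hsum : (⟪a, b - a⟫_ℂ).re + (⟪b, a - b⟫_ℂ).re = -‖a - b‖ ^ 2 := by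
    have e1 : ⟪a, b - a⟫_ℂ + ⟪b, a - b⟫_ℂ = -⟪a - b, a - b⟫_ℂ := by
      simp only [inner_sub_left, inner_sub_right]; ring
    have e2 := congrArg Complex.re e1
    rw [Complex.add_re, Complex.neg_re, inner_self_eq_coe_norm_sq, Complex.ofReal_re] at e2
    exact e2
  have : ‖a - b‖ ^ 2 ≤ 0 := by linarith
  have : ‖a - b‖ = 0 := by nlinarith [norm_nonneg (a - b)]
  exact sub_eq_zero.1 (norm_eq_zero.1 this)
end IsMinimal

end Literature.Analysis.OperatorTheory.Enflo2023

end
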